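import Summits.Parity.GeneralizedHardyLittlewood.Theorems.FordMaynardNoSieveConst0164NegWitness0164DefsTable

/-!
# Route `FordMaynardNoSieveConst0164`, crux `NegWitness0164` (stmt-Parity-19102), line `birth`,
# stub `stub_tweakNeg0164`: reduction of (II') to its finitely many one-parameter families

Helper file (def-free) for the numerical target (II') of `…NegWitness0164Numerics` / `…Scaled`
(K. Ford, J. Maynard, *On the theory of prime producing sieves*, arXiv:2407.14368, §8, the functions `f_{2,1}(β₁,β₂,α)`).
In (II') the two frozen coordinates `b = (b₀, b₁) ∈ [ν, 1/2)²` lie in unique grid cells `j₀, j₁ < 24`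
(`e_j = 41/250 + 7j/500`), only the table entries `lpCoeff0164 (τ, j₀, j₁)`, `τ : Fin 3 → Fin 24`, contribute, the
left-hand side depends on `b` only through `(j₀, j₁)` and `α = 1 − b₀ − b₁`, and a nonzero entry forces `j₀ + j₁ ≤ 10`
(pair-edge condition).  `II_of_families_0164`: for any right-hand side `R(α) ≥ 0`, (II') with right-hand side `R(1 − Σb)`
follows from the 66 (ordered; 36 up to symmetry) ONE-PARAMETER family inequalities

  `j₀ + j₁ ≤ 10`, `α ∈ [max(1/2, 1 − e_{j₀+1} − e_{j₁+1}), 1 − e_{j₀} − e_{j₁}]`: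
  `(α/6) Σ_{τ : Fin 3 → Fin 24} lpCoeff0164(τ,j₀,j₁) · ∫_{Δ₃(α)} 𝟙[vᵢ ∈ cell τᵢ]/(v₀v₁v₂) ≤ R(α)`.

References: [FordMaynard2024PrimeSieves] arXiv:2407.14368, §8 (proof of Theorem 2.7 (c)).
-/

noncomputable section

open Finset MeasureTheory Set
open scoped Classical
open Literature.NumberTheory.Sieve Literature.NumberTheory.Sieve.FordMaynard

namespace Summit.Parity.GeneralizedHardyLittlewood.FordMaynardNoSieveConst0164NegWitness0164

/-- **Cell index of a frozen coordinate.** For `ν ≤ x < 1/2` there is `j < 24` with `e_j ≤ x < e_{j+1}`, and the cell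
is unique. [folklore] -/
theorem exists_cell_index_0164 {x : ℝ} (hx : (41 / 250 : ℝ) ≤ x) (hx' : x < 1 / 2) :
    ∃ j : Fin 24, (41 / 250 + (j : ℕ) * (7 / 500) : ℝ) ≤ x ∧ x < 41 / 250 + ((j : ℕ) + 1) * (7 / 500) := by
  set y : ℝ := (x - 41 / 250) / (7 / 500) with hy
  have hy0 : 0 ≤ y := div_nonneg (by linarith) (by norm_num)
  have hy24 : y < 24 := by rw [hy, div_lt_iff₀ (by norm_num : (0:ℝ) < 7 / 500)]; linarith
  have hfl : (⌊y⌋₊ : ℝ) ≤ y := Nat.floor_le hy0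
  have hfl' : y < (⌊y⌋₊ : ℝ) + 1 := Nat.lt_floor_add_one y
  have hlt : ⌊y⌋₊ < 24 := by
    have : (⌊y⌋₊ : ℝ) < 24 := lt_of_le_of_lt hfl hy24
    exact_mod_cast this
  refine ⟨⟨⌊y⌋₊, hlt⟩, ?_, ?_⟩
  · have : (⌊y⌋₊ : ℝ) * (7 / 500) ≤ x - 41 / 250 := by
      rw [hy] at hfl; rwa [le_div_iff₀ (by norm_num : (0:ℝ) < 7 / 500)] at hfl
    linarith
  · have : x - 41 / 250 < ((⌊y⌋₊ : ℝ) + 1) * (7 / 500) := by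
      rw [hy] at hfl'; rwa [div_lt_iff₀ (by norm_num : (0:ℝ) < 7 / 500)] at hfl'
    linarith

/-- Uniqueness of the cell: if `x` lies in cell `j` and in cell `k` then `k = j`. [folklore] -/
theorem cell_index_unique_0164 {x : ℝ} {j k : Fin 24}
    (hj : (41 / 250 + (j : ℕ) * (7 / 500) : ℝ) ≤ x ∧ x < 41 / 250 + ((j : ℕ) + 1) * (7 / 500))
    (hk : (41 / 250 + (k : ℕ) * (7 / 500) : ℝ) ≤ x ∧ x < 41 / 250 + ((k : ℕ) + 1) * (7 / 500)) : k = j := by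
  have h1 : ((k : ℕ) : ℝ) < (j : ℕ) + 1 := by nlinarith [hj.2, hk.1]
  have h2 : ((j : ℕ) : ℝ) < (k : ℕ) + 1 := by nlinarith [hk.2, hj.1]
  have h1' : (k : ℕ) < (j : ℕ) + 1 := by exact_mod_cast h1
  have h2' : (j : ℕ) < (k : ℕ) + 1 := by exact_mod_cast h2
  exact Fin.ext (by omega)

/-- A nonzero table entry `lpCoeff0164 (τ, j₀, j₁)` forces `j₀ + j₁ ≤ 10` (pair-edge condition on the two frozen
coordinates). [cite: FordMaynard2024PrimeSieves, §8 (support of f_{5,0})] -/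
theorem frozen_pair_le_ten_0164 (τ : Fin 3 → Fin 24) (j : Fin 2 → Fin 24)
    (h : lpCoeff0164 (Fin.append τ j) ≠ 0) : (j 0 : ℕ) + (j 1 : ℕ) ≤ 10 := by
  have hp := lpCoeff0164_pair _ h (Fin.natAdd 3 (0 : Fin 2)) (Fin.natAdd 3 (1 : Fin 2)) (by decide)
  simp only [Fin.append_right] at hp
  have : ((j 0 : ℕ) : ℝ) + ((j 1 : ℕ) : ℝ) ≤ 10 + 2 / 7 := by nlinarith [hp]
  have h' : ((j 0 : ℕ) + (j 1 : ℕ) : ℕ) < 11 := by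
    have : (((j 0 : ℕ) + (j 1 : ℕ) : ℕ) : ℝ) < 11 := by push_cast; linarith
    exact_mod_cast this
  omega

/-- **Reduction of (II') to one-parameter families.** Let `R ≥ 0` on `[1/2, 1 − 2ν]`.  If for every ordered pair of
frozen cells `(j₀, j₁)` with `j₀ + j₁ ≤ 10` and every `α` with `1/2 ≤ α`, `1 − e_{j₀+1} − e_{j₁+1} ≤ α ≤ 1 − e_{j₀} − e_{j₁}`
the family inequality `(α/6) Σ_τ lpCoeff0164(τ,j₀,j₁) ∫_{Δ₃(α)} 𝟙[vᵢ ∈ cell τᵢ]/(v₀v₁v₂) ≤ R(α)` holds, then (II')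
holds with right-hand side `R(1 − Σb)`. [cite: FordMaynard2024PrimeSieves, §8 (proof of Theorem 2.7 (c))] -/
theorem II_of_families_0164 (R : ℝ → ℝ)
    (hR : ∀ α : ℝ, 1 / 2 ≤ α → α ≤ 1 - 2 * (41 / 250) → 0 ≤ R α)
    (h : ∀ j : Fin 2 → Fin 24, (j 0 : ℕ) + (j 1 : ℕ) ≤ 10 → ∀ α : ℝ, 1 / 2 ≤ α →
      1 - (41 / 250 + ((j 0 : ℕ) + 1) * (7 / 500)) - (41 / 250 + ((j 1 : ℕ) + 1) * (7 / 500)) ≤ α →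
      α ≤ 1 - (41 / 250 + (j 0 : ℕ) * (7 / 500)) - (41 / 250 + (j 1 : ℕ) * (7 / 500)) →
      α / 6 * ∑ τ : Fin 3 → Fin 24, lpCoeff0164 (Fin.append τ j) * sliceIntegral 3 α (fun v =>
        if ∀ i, (41 / 250 + (τ i : ℕ) * (7 / 500) : ℝ) ≤ v i ∧ v i < 41 / 250 + ((τ i : ℕ) + 1) * (7 / 500) then
          1 / (v 0 * v 1 * v 2) else 0) ≤ R α) :
    ∀ b : Fin 2 → ℝ, (∀ i, (41 / 250 : ℝ) ≤ b i) → (∀ i, b i < 1 / 2) → ∑ i, b i ≤ 1 / 2 →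
      (1 - ∑ i, b i) / 6 * ∑ t : Fin 5 → Fin 24, lpCoeff0164 t * sliceIntegral 3 (1 - ∑ i, b i) (fun v =>
        if ∀ i, (41 / 250 + (t i : ℕ) * (7 / 500) : ℝ) ≤ (Fin.append v b) i ∧
          (Fin.append v b) i < 41 / 250 + ((t i : ℕ) + 1) * (7 / 500) then 1 / (v 0 * v 1 * v 2) else 0) ≤
      R (1 - ∑ i, b i) := by
  intro b hb hb' hbs
  -- the cells of the frozen coordinates
  choose j hj using fun i => exists_cell_index_0164 (hb i) (hb' i)
  set α : ℝ := 1 - ∑ i, b i with hα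
  -- the integrand of `t` vanishes unless `t` ends with `j`, in which case it is the free-cell integrand
  have hint : ∀ t : Fin 5 → Fin 24, sliceIntegral 3 α (fun v =>
      if ∀ i, (41 / 250 + (t i : ℕ) * (7 / 500) : ℝ) ≤ (Fin.append v b) i ∧
        (Fin.append v b) i < 41 / 250 + ((t i : ℕ) + 1) * (7 / 500) then 1 / (v 0 * v 1 * v 2) else 0) =
      if (fun i => t (Fin.natAdd 3 i)) = j then sliceIntegral 3 α (fun v =>
        if ∀ i, (41 / 250 + (t (Fin.castAdd 2 i) : ℕ) * (7 / 500) : ℝ) ≤ v i ∧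
          v i < 41 / 250 + ((t (Fin.castAdd 2 i) : ℕ) + 1) * (7 / 500) then 1 / (v 0 * v 1 * v 2) else 0) else 0 := by
    intro t
    by_cases ht : (fun i => t (Fin.natAdd 3 i)) = j
    · rw [if_pos ht]
      refine congrArg (sliceIntegral 3 α) (funext fun v => ?_)
      have hiff : (∀ i, (41 / 250 + (t i : ℕ) * (7 / 500) : ℝ) ≤ (Fin.append v b) i ∧
          (Fin.append v b) i < 41 / 250 + ((t i : ℕ) + 1) * (7 / 500)) ↔
          ∀ i, (41 / 250 + (t (Fin.castAdd 2 i) : ℕ) * (7 / 500) : ℝ) ≤ v i ∧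
            v i < 41 / 250 + ((t (Fin.castAdd 2 i) : ℕ) + 1) * (7 / 500) := by
        constructor
        · intro hh i
          simpa only [Fin.append_left] using hh (Fin.castAdd 2 i)
        · intro hh
          refine Fin.addCases (m := 3) (n := 2) (fun i => ?_) (fun i => ?_)
          · simpa only [Fin.append_left] using hh i
          · have hti : t (Fin.natAdd 3 i) = j i := congrFun ht i
            simp only [Fin.append_right, hti]
            exact hj i
      simp only [hiff]
    · rw [if_neg ht]
      rw [show (fun v : Fin 3 → ℝ => if ∀ i, (41 / 250 + (t i : ℕ) * (7 / 500) : ℝ) ≤ (Fin.append v b) i ∧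
          (Fin.append v b) i < 41 / 250 + ((t i : ℕ) + 1) * (7 / 500) then 1 / (v 0 * v 1 * v 2) else 0) =
          fun _ => 0 from ?_, sliceIntegral_zero]
      funext v
      rw [if_neg]
      intro hh
      apply ht
      funext i
      have h2 := hh (Fin.natAdd 3 i)
      simp only [Fin.append_right] at h2
      exact cell_index_unique_0164 (hj i) h2
  -- reindex the sum over `t = (τ, κ)`
  have hsum : ∑ t : Fin 5 → Fin 24, lpCoeff0164 t * sliceIntegral 3 α (fun v =>
      if ∀ i, (41 / 250 + (t i : ℕ) * (7 / 500) : ℝ) ≤ (Fin.append v b) i ∧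
        (Fin.append v b) i < 41 / 250 + ((t i : ℕ) + 1) * (7 / 500) then 1 / (v 0 * v 1 * v 2) else 0) =
      ∑ τ : Fin 3 → Fin 24, lpCoeff0164 (Fin.append τ j) * sliceIntegral 3 α (fun v =>
        if ∀ i, (41 / 250 + (τ i : ℕ) * (7 / 500) : ℝ) ≤ v i ∧ v i < 41 / 250 + ((τ i : ℕ) + 1) * (7 / 500) then
          1 / (v 0 * v 1 * v 2) else 0) := by
    simp_rw [hint]
    rw [← Fintype.sum_equiv (Fin.appendEquiv 3 2) (fun p => lpCoeff0164 (Fin.append p.1 p.2) *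
      (if (fun i => (Fin.append p.1 p.2) (Fin.natAdd 3 i)) = j then sliceIntegral 3 α (fun v =>
        if ∀ i, (41 / 250 + ((Fin.append p.1 p.2) (Fin.castAdd 2 i) : ℕ) * (7 / 500) : ℝ) ≤ v i ∧
          v i < 41 / 250 + (((Fin.append p.1 p.2) (Fin.castAdd 2 i) : ℕ) + 1) * (7 / 500) then
          1 / (v 0 * v 1 * v 2) else 0) else 0)) _ (fun p => rfl)]
    rw [Fintype.sum_prod_type]
    refine Finset.sum_congr rfl fun τ _ => ?_
    simp only [Fin.append_left, Fin.append_right]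
    rw [Finset.sum_eq_single j]
    · simp
    · intro κ _ hκ
      rw [if_neg (fun hh => hκ (funext fun i => congrFun hh i)), mul_zero]
    · intro hj'; exact absurd (Finset.mem_univ j) hj'
  rw [hsum]
  -- the range of `α`
  have hα_half : 1 / 2 ≤ α := by rw [hα]; linarith
  have hsum2 : ∑ i, b i = b 0 + b 1 := Fin.sum_univ_two b
  have hα_lo : 1 - (41 / 250 + ((j 0 : ℕ) + 1) * (7 / 500)) - (41 / 250 + ((j 1 : ℕ) + 1) * (7 / 500)) ≤ α := by
    rw [hα, hsum2]; linarith [(hj 0).2, (hj 1).2]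
  have hα_hi : α ≤ 1 - (41 / 250 + (j 0 : ℕ) * (7 / 500)) - (41 / 250 + (j 1 : ℕ) * (7 / 500)) := by
    rw [hα, hsum2]; linarith [(hj 0).1, (hj 1).1]
  by_cases hten : (j 0 : ℕ) + (j 1 : ℕ) ≤ 10
  · exact h j hten α hα_half hα_lo hα_hi
  · -- no table entry: the left-hand side vanishes
    have hzero : ∀ τ : Fin 3 → Fin 24, lpCoeff0164 (Fin.append τ j) = 0 := fun τ => by
      by_contra hne
      exact hten (frozen_pair_le_ten_0164 τ j hne)
    simp only [hzero, zero_mul, Finset.sum_const_zero, mul_zero]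
    refine hR α hα_half ?_
    rw [hα, hsum2]; linarith [hb 0, hb 1]

end Summit.Parity.GeneralizedHardyLittlewood.FordMaynardNoSieveConst0164NegWitness0164

end
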